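import Literature.Computability.QuantumComplexity.RoundedGaussianPermanent
import HarnessLib

/-!
# The rounded Gaussian matrix: the range event

Family `quantum-advantage`, a REAL-side estimate of the discharge of Aaronson–Arkhipov's Thm. 1.3
(`gpeSolvableInFBPPRel_NPRel_of_approxBosonSamplingOracle`), sequel of
`RoundedGaussianDomination.lean` (`InRange T x̃`: every coordinate of the rounded input has modulus
`< T`) and `RoundedGaussianPermanent.lean` (the entry tail `real_exists_entry_norm_gt_le`):

* `lt_abs_of_le_natAbs_round` — `T ≤ |round(2ᵇ x)|` forces `(T - 1)/2ᵇ < |x|`;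
* **`real_not_inRange_le`** — `Pr_X[X̃ out of range T] ≤ n² · 2e^{-((T-1)/2ᵇ)²/2}` for `T ≥ 1`.

All proved.

## References

* S. Aaronson, A. Arkhipov, *The computational complexity of linear optics*, Theory of Computing 9
  (2013) 143–252, Lemma 5.3 (p. 185, Gaussian tails) and §2 (p. 161).
-/

noncomputable section

namespace Literature.Computability.QuantumComplexity

open MeasureTheory ProbabilityTheory Finset Literature.Computability.Cryptography
  Literature.Computability.Complexity Literature.Probability.Distributions
open scoped NNReal

variable {n : ℕ}

/-- **A large rounding forces a large coordinate**: `T ≤ |round(2ᵇ x)|` gives `(T - 1)/2ᵇ < |x|`.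
[folklore] -/
theorem lt_abs_of_le_natAbs_round (b T : ℕ) (x : ℝ) (h : T ≤ (round ((2 : ℝ) ^ b * x)).natAbs) :
    ((T : ℝ) - 1) / 2 ^ b < |x| := by
  have hN : (0 : ℝ) < (2 : ℝ) ^ b := by positivity
  have h1 : (T : ℝ) ≤ |(round ((2 : ℝ) ^ b * x) : ℝ)| := by
    rw [← Int.cast_abs, Int.abs_eq_natAbs]
    exact_mod_cast h
  have h2 : |(round ((2 : ℝ) ^ b * x) : ℝ)| ≤ |(2 : ℝ) ^ b * x| + 1 / 2 := by
    have := abs_sub_round ((2 : ℝ) ^ b * x)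
    have := abs_sub_abs_le_abs_sub ((round ((2 : ℝ) ^ b * x) : ℝ)) ((2 : ℝ) ^ b * x)
    rw [abs_sub_comm] at this
    linarith
  rw [abs_mul, abs_of_pos hN] at h2
  rw [div_lt_iff₀ hN]
  nlinarith

/-- **The range event**: `Pr_X[X̃ out of range T] ≤ n² · 2e^{-((T-1)/2ᵇ)²/2}` (`T ≥ 1`): an
out-of-range coordinate is a large real or imaginary part, hence a large entry.
[cite: AaronsonArkhipovToC2013, Lemma 5.3 (p. 185)] -/
theorem real_not_inRange_le (b : ℕ) {T : ℕ} (hT : 1 ≤ T) :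
    (gaussianMatrixMeasure n).real {X | ¬ InRange T (roundedInput b X)} ≤
      (n : ℝ) ^ 2 * (2 * Real.exp (-((((T : ℝ) - 1) / 2 ^ b) ^ 2 / 2))) := by
  have hL : 0 ≤ ((T : ℝ) - 1) / 2 ^ b := by
    have : (1 : ℝ) ≤ T := by exact_mod_cast hT
    positivity
  refine (measureReal_mono (fun X hX => ?_)).trans (real_exists_entry_norm_gt_le (n := n) hL)
  simp only [Set.mem_setOf_eq, InRange, not_forall, not_and_or, not_lt] at hX ⊢
  obtain ⟨i, j, hij⟩ := hX
  refine ⟨i, j, ?_⟩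
  rcases hij with h | h
  · exact (lt_abs_of_le_natAbs_round b T (X i j).re h).trans_le (Complex.abs_re_le_norm _)
  · exact (lt_abs_of_le_natAbs_round b T (X i j).im h).trans_le (Complex.abs_im_le_norm _)

end Literature.Computability.QuantumComplexity
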